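import Literature.NumberTheory.BeurlingPrimes.BDRPerron
import Literature.NumberTheory.BeurlingPrimes.WellBehavedSystemsProofs
import Literature.NumberTheory.BeurlingPrimes.WellBehavedSystemsThm31Holds
import Literature.NumberTheory.BeurlingPrimes.WellBehavedCor33
import Literature.NumberTheory.BeurlingPrimes.WellBehavedCor34
import Literature.Barriers.RiemannHypothesis.BeurlingCounterexamplesHilberdinkProofs
import HarnessLib

/-!
# Broucke–Debruyne–Révész 2023, Theorem 3.2 — the discharge, and Corollaries 3.3–3.4

Topic `Literature/NumberTheory/BeurlingPrimes`. Everything in this file is PROVED (sibling proofs file of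
`WellBehavedSystems.lean`, whose named facts `BrouckeDebruyneRevesz2023_thm32`, `…_cor33`, `…_cor34` it discharges).

**Theorem 3.2** (F. Broucke, G. Debruyne, Sz. Gy. Révész, *Some examples of well-behaved Beurling number systems*,
arXiv:2309.01567, Trans. AMS 2024; vendored for real simple zeros `ℛ = R` and poles `𝒮 = S`): for finite disjoint
`R, S ⊂ (0,1)` and `0 < δ < 1/2` there is a Beurling system `𝒫` with
`ψ_𝒫(x) = x + Σ_ω x^ω/ω − Σ_ρ x^ρ/ρ + O(x^δ)`, `N_𝒫(x) = ax + Σ_{ω>1/2} b_ω x^ω + O(x^{1/2}e^{c(log x)^{2/3}})`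
(`a > 0`, `b_ω ≠ 0`), and `ζ_𝒫(s) = E_M(s) e^{Z(s)}` with `Z` holomorphic on `Re s > 0` and the bound (3.4).
The proof follows the printed one (§3, pp. 7–9) step by step, through the tree:

1. Lemma 3.1 (`BDR.exists_adm`, `BDRTemplate.lean`): a large `M` makes the template
   `F = li + Σ_ω li(x^ω) − Σ_ρ li(x^ρ) + M li(x^δ)` increasing;
2. Theorem 1.2 = Broucke–Vindas's random prime approximation (`BrouckeVindas2024_thm12_holds`, PROVED in the tree)
   applied to `F` (`BDR.FStieltjes`, `BDRTemplateStieltjes.lean`) gives `𝒫` with `|π_𝒫 − F| ≤ 2` and (1.3);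
3. `Π_𝒫 = G + O(log log x)` and `ψ_𝒫 = ∫ log u dΠ_𝒫` give the first assertion (`BDRRiemannCount.lean`);
4. `Z = ℳ{dΠ_𝒫 − dG; s}` is holomorphic on `Re s > 0`, `ζ_𝒫 = E e^Z`, and (3.4) holds (`BDRZeta.lean`, through
   the tree's Broucke–Vindas continuation `BVContinuation.lean` for the truncated density);
5. Perron inversion with the contour moved to `σ_x = 1/2 + (log x)^{−1/3}` across the poles `1` and `ω > 1/2`
   (`BDRPerronPoles.lean`, `BDRPerron.lean`, on the tree's `PerronShift.lean`) gives the second assertion.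

Then **Corollary 3.3** (`BrouckeDebruyneRevesz2023_cor33_holds`, via the tree's `…_cor33_of_thm32`) and
**Corollary 3.4** (`BrouckeDebruyneRevesz2023_cor34_holds`, via `…_cor34_of_thm32`, Hilberdink's theorem
`Hilberdink2005_thm1_holds` and the BV `[0,1/2]`-system `BrouckeVindas2024_thm31_holds`) follow.

## References
* [BrouckeDebruyneRevesz2023] F. Broucke, G. Debruyne, Sz. Gy. Révész, *Some examples of well-behaved Beurling
  number systems*, arXiv:2309.01567, Lemma 3.1, Theorem 3.2, Corollaries 3.3–3.4 and their proofs (read, pp. 7–9).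
* [BrouckeVindas2024] F. Broucke, J. Vindas, Math. Z. 307 (2024), arXiv:2102.08478, Theorem 1.2.
* [Hilberdink2005] T. W. Hilberdink, J. Number Theory 112 (2005), Theorem 1.
-/

noncomputable section

open Complex Set Filter MeasureTheory Real

namespace Literature.NumberTheory.BeurlingPrimes

open Literature.Barriers.RiemannHypothesis

/-- **Broucke–Debruyne–Révész 2023, Theorem 3.2** (real simple zeros and poles), proved.
[cite: BrouckeDebruyneRevesz2023, Theorem 3.2] -/
theorem BrouckeDebruyneRevesz2023_thm32_holds : BrouckeDebruyneRevesz2023_thm32 := by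
  intro R S δ hRS hR hS hδ0 hδ2
  -- Step 1: Lemma 3.1
  obtain ⟨M₀, hM₀⟩ := BDR.exists_adm (R := R) (S := S) hR hS hδ0 (by linarith : δ < 1)
  have h : BDR.Adm R S δ M₀ := hM₀ M₀ le_rfl
  -- Step 2: Theorem 1.2 for `F`
  have hF1 : BDR.FStieltjes h 1 = 0 := by rw [BDR.FStieltjes_apply]; exact BDR.F_one
  obtain ⟨⟨P, hπ, C, hC⟩, -⟩ := BrouckeVindas2024_thm12_holds (BDR.FStieltjes h) hF1
    (fun x ↦ h.F_nonneg x) h.tendsto_F_atTop h.FStieltjes_chebyshev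
  have hπ' : ∀ y : ℝ, 1 ≤ y → |(P.primeCount y : ℝ) - BDR.F R S δ M₀ y| ≤ 2 := fun y _ ↦ hπ y
  have hApprox : BV.Approx (BDR.f R S δ M₀) P C := by
    intro x hx t
    have h1 := hC t x hx
    rwa [h.stieltjesExpSum_FStieltjes hx t] at h1
  have hd : BDR.PerronData R S δ M₀ P C 2 := ⟨h, hδ2, hApprox, hπ'⟩
  refine ⟨P, ?_, hd.intCount_clause hRS, ?_⟩
  · -- the first assertion
    exact h.exists_abs_chebyshevPsi_sub_le P hπ'
  · -- `ζ_𝒫 = E_M e^Z`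
    obtain ⟨K, -, hK⟩ := h.norm_Z_le P hApprox hπ'
    refine ⟨M₀, BDR.Z R S δ M₀ P, K, h.differentiableOn_Z P hπ', hK, fun s hs ↦ ?_⟩
    rw [h.zeta_eq_E_mul_exp_Z P hApprox hπ' hs, BDR.E]

/-- **Broucke–Debruyne–Révész 2023, Corollary 3.3** (`1/2 ≤ β ≤ α < 1` ⇒ an `[α,β]`-system exists), proved:
Theorem 3.2 fed into the tree's derivation `BrouckeDebruyneRevesz2023_cor33_of_thm32` (`ℛ = {α}` or `∅`,
`𝒮 = {β}`, and the pole of `ζ_𝒫` at `1/2` when `β = 1/2`). [cite: BrouckeDebruyneRevesz2023, Corollary 3.3] -/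
theorem BrouckeDebruyneRevesz2023_cor33_holds : BrouckeDebruyneRevesz2023_cor33 :=
  BrouckeDebruyneRevesz2023_cor33_of_thm32 BrouckeDebruyneRevesz2023_thm32_holds

/-- **Broucke–Debruyne–Révész 2023, Corollary 3.4** (`0 ≤ α < 1/2` ⇒ an `[α,1/2]`-system exists), proved:
Theorem 3.2 (`ℛ = {α}`, `𝒮 = ∅`), Hilberdink's uncertainty principle and, for `α = 0`, the Broucke–Vindas
`[0,1/2]`-system, through the tree's `BrouckeDebruyneRevesz2023_cor34_of_thm32`. [cite: BrouckeDebruyneRevesz2023, Corollary 3.4] -/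
theorem BrouckeDebruyneRevesz2023_cor34_holds : BrouckeDebruyneRevesz2023_cor34 :=
  BrouckeDebruyneRevesz2023_cor34_of_thm32 BrouckeDebruyneRevesz2023_thm32_holds Hilberdink2005_thm1_holds
    BrouckeVindas2024_thm31_holds

end Literature.NumberTheory.BeurlingPrimes
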